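import Summits.FinalStateConjecture.FinalStateConjecture.Theorems.BartnikGapSettlingGapExhaustionNodeChartPackage
import Summits.FinalStateConjecture.FinalStateConjecture.Theorems.BartnikGapSettlingGapExhaustionOpenSubsetChronologicalPast
import Literature.Geometry.Lorentzian.CausalityChronologyProofs
import HarnessLib

/-!
# Crux `GapExhaustion` (stmt-FinalStateConjecture-10808), line `photon-shell-pseudoconvexity`:
# the d.o.c. seen by an eternal near-Kerr star chart does not depend on the far zone that
# defines it — `I⁻(S) = docOf` for every `S` sandwiched between two far zones (rev c13)

Route `BartnikGapSettling`; helper (`--supports stmt-FinalStateConjecture-10808`) of line lead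
c13 — the set-bookkeeping input of the S6 re-split (`StubStationaryRecharting`, skeleton §3f): a
re-charting `Ψ' = Ψ ∘ σ` of the star domain moving Kerr–Schild radii by at most `M/4` has
`Ψ'({r > 3M})` sandwiched between `Ψ({r > 13M/4})` and `Ψ({r > 11M/4})`, hence the SAME domain of
outer communications `docOf = I⁻(Ψ({r > 3M}))` and the same charted horizon. Contents:
`farSilent_band_subset_pastFarZone_of` (the §1f localisation with the far radius `R` as a
parameter: under `FarSilentNearKerr` at order `≥ 1` and a small tolerance, the band
`{r₊ + η ≤ r ≤ R}` lies in `I⁻(farZone R)` — the generic form of the landed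
`farSilent_band_subset_docOf_of`, which is its case `R ≥ 3M` followed by monotonicity), its
label-uniform version `…pastFarZoneU`, two chronology one-liners (`I⁻ ∘ I⁻ ⊆ I⁻`, squeeze), and
`docOf_eq_chronologicalPast_of_sandwichU`. Bricks: `Theorems.stub_docLocalisation[U]`,
`stub_kerrBilin_coercive_exterior[U]`, `stub_starChartExtension`, `stub_injective_mfderiv_of_close`,
`stub_subset_chronologicalPast_of_isOpen` (F4), `mem_chronologicalFuture_trans`.
[cite: ONeill1983, Ch. 14, p. 402] [cite: DafermosRodnianski2008, §5.1]
-/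

noncomputable section

set_option maxSynthPendingDepth 3

-- D-0017: single-problem summit, `Summit.<S>.<S>.…` by design (cf. lakefile `weak.linter.dupNamespace`).
set_option linter.dupNamespace false

namespace Summit.FinalStateConjecture.FinalStateConjecture.Theorems.PhotonShellNode

open Literature.Geometry.Lorentzian
open Set Filter
open scoped Manifold ContDiff Topology ENNReal

/-- **§1f with the far radius as a parameter.** Under `FarSilentNearKerr` at order `k ≥ 1` and
tolerance `δ' ≤ min (β/2) (δ min 1 M)` (`β` the coercivity constant of the Kerr–Schild form on
`{r ≥ M}`, `δ` the tolerance of `Theorems.stub_docLocalisation M a η R`), every point of the band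
`{r₊ + η ≤ r ≤ R}` of the star chart lies in `I⁻(farZone R)`. Proof verbatim that of the landed
`farSilent_band_subset_docOf_of` without its final monotonicity step. [folklore] -/
theorem farSilent_band_subset_pastFarZone_of {M a η R δ β : ℝ} (hM : 0 < M) (hη : 0 < η)
    (hδ : 0 < δ) (hβ : 0 < β)
    (hcoer : ∀ z : E4, M ≤ Kerr.radius a z → ∀ v : E4, β * ‖v‖ ≤ ‖Kerr.bilin M a z v‖)
    (hloc : ∀ (𝓢 : Spacetime.{0} 4) (Φ : E4 → 𝓢.carrier),
      ContMDiffOn 𝓘(ℝ, E4) (𝓡 4) ∞ Φ {z | M < Kerr.radius a z} →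
      (∀ z : E4, M < Kerr.radius a z → Function.Injective (mfderiv 𝓘(ℝ, E4) (𝓡 4) Φ z)) →
      (∀ z : E4, Kerr.rPlus M a + η / 2 ≤ Kerr.radius a z → Kerr.radius a z ≤ R + 2 →
        ‖𝓢.metricInCoords Φ z - Kerr.bilin M a z‖ ≤ δ ∧
        ‖fderiv ℝ (𝓢.metricInCoords Φ) z - fderiv ℝ (Kerr.bilin M a) z‖ ≤ δ) →
      ∀ z : E4, Kerr.rPlus M a + η ≤ Kerr.radius a z → Kerr.radius a z ≤ R →
        Φ z ∈ 𝓢.metric.chronologicalPast 𝓢.timeOrientation (Φ '' {y | R < Kerr.radius a y})) :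
    ∀ (𝓢 : Spacetime.{0} 4) [𝓢.metric.HasLeviCivita] (Ψ : (starBG M a).domain → 𝓢.carrier)
      (k : ℕ) (δ' : ℝ), 1 ≤ k → δ' ≤ min (β / 2) (δ * min 1 M) → FarSilentNearKerr 𝓢 M a Ψ k δ' →
      ∀ x : (starBG M a).domain, Kerr.rPlus M a + η ≤ Kerr.radius a x.1 →
        Kerr.radius a x.1 ≤ R →
        Ψ x ∈ 𝓢.metric.chronologicalPast 𝓢.timeOrientation (farZone 𝓢 M a Ψ R) := by
  set δ₀ : ℝ := min (β / 2) (δ * min 1 M) with hδ₀def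
  have hδ₀ : 0 < δ₀ := lt_min (by positivity) (by positivity)
  have hδ₀β : δ₀ < β := (min_le_left _ _).trans_lt (by linarith)
  have hδ₀δ : δ₀ ≤ δ := (min_le_right _ _).trans
    ((mul_le_mul_of_nonneg_left (min_le_left _ _) hδ.le).trans (mul_one δ).le)
  have hδ₀δM : δ₀ ≤ δ * M := (min_le_right _ _).trans (mul_le_mul_of_nonneg_left (min_le_right _ _) hδ.le)
  intro 𝓢 _ Ψ k δ' hk hδ' hFS x hxlo hxR
  obtain ⟨-, hΨs, hΨe, hbound⟩ := hFS
  obtain ⟨Φ, hΦΨ, hdom, hΦs, -, -, hiter⟩ :=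
    Theorems.stub_starChartExtension 𝓢 M a Ψ hM hΨs hΨe
  have hrpM : M ≤ Kerr.rPlus M a := le_add_of_nonneg_right (Real.sqrt_nonneg _)
  have hmem : ∀ z : E4, M < Kerr.radius a z → z ∈ ((starBG M a).domain : Set E4) := by
    intro z hz; rw [← hdom]; exact hz
  have hC0 : ∀ z : E4, M < Kerr.radius a z →
      ‖𝓢.metricInCoords Φ z - Kerr.bilin M a z‖ ≤ δ' * M / Kerr.radius a z := by
    intro z hz
    have hb := hbound ⟨z, hmem z hz⟩ 0 (Nat.zero_le _)
    have hit := hiter 0 ⟨z, hmem z hz⟩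
    simp only [zero_add, pow_one] at hb
    rw [le_div_iff₀ (hM.trans hz), mul_comm]
    have : ‖iteratedFDeriv ℝ 0 (fun z ↦ 𝓢.metricInCoords Φ z - Kerr.bilin M a z) z‖ =
        ‖𝓢.metricInCoords Φ z - Kerr.bilin M a z‖ := norm_iteratedFDeriv_zero
    rw [← this]
    simpa [hit] using hb
  have hO : IsOpen {z : E4 | M < Kerr.radius a z} := isOpen_lt continuous_const (Kerr.continuous_radius a)
  have hGs : ContDiffOn ℝ ∞ (𝓢.metricInCoords Φ) {z : E4 | M < Kerr.radius a z} :=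
    𝓢.contDiffOn_metricInCoords hO hΦs
  have hC1 : ∀ z : E4, M < Kerr.radius a z →
      ‖fderiv ℝ (𝓢.metricInCoords Φ) z - fderiv ℝ (Kerr.bilin M a) z‖ ≤
        δ' * M / Kerr.radius a z ^ 2 := by
    intro z hz
    have hr : 0 < Kerr.radius a z := hM.trans hz
    have hb := hbound ⟨z, hmem z hz⟩ 1 hk
    have hit := hiter 1 ⟨z, hmem z hz⟩
    have hGd : DifferentiableAt ℝ (𝓢.metricInCoords Φ) z :=
      ((hGs z hz).contDiffAt (hO.mem_nhds hz)).differentiableAt (by simp)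
    have hKd : DifferentiableAt ℝ (Kerr.bilin M a) z :=
      (Kerr.contDiffAt_bilin M a hr (n := 1)).differentiableAt one_ne_zero
    have h1 : ‖iteratedFDeriv ℝ 1 (fun z ↦ 𝓢.metricInCoords Φ z - Kerr.bilin M a z) z‖ =
        ‖fderiv ℝ (𝓢.metricInCoords Φ) z - fderiv ℝ (Kerr.bilin M a) z‖ := by
      rw [norm_iteratedFDeriv_one, fderiv_fun_sub hGd hKd]
    rw [le_div_iff₀ (by positivity), mul_comm, ← h1]
    simpa [hit] using hb
  have hinj : ∀ z : E4, M < Kerr.radius a z → Function.Injective (mfderiv 𝓘(ℝ, E4) (𝓡 4) Φ z) := by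
    intro z hz
    have hr : 0 < Kerr.radius a z := hM.trans hz
    refine Theorems.stub_injective_mfderiv_of_close.1 𝓢 Φ z (Kerr.bilin M a z) β hβ
      (hcoer z hz.le) ?_
    calc ‖𝓢.metricInCoords Φ z - Kerr.bilin M a z‖ ≤ δ' * M / Kerr.radius a z := hC0 z hz
      _ ≤ δ₀ := by
          rw [div_le_iff₀ hr]
          have h1 : δ' * M ≤ δ₀ * M := mul_le_mul_of_nonneg_right hδ' hM.le
          have h2 : δ₀ * M ≤ δ₀ * Kerr.radius a z := mul_le_mul_of_nonneg_left hz.le hδ₀.le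
          linarith
      _ < β := hδ₀β
  have hclose : ∀ z : E4, Kerr.rPlus M a + η / 2 ≤ Kerr.radius a z → Kerr.radius a z ≤ R + 2 →
      ‖𝓢.metricInCoords Φ z - Kerr.bilin M a z‖ ≤ δ ∧
      ‖fderiv ℝ (𝓢.metricInCoords Φ) z - fderiv ℝ (Kerr.bilin M a) z‖ ≤ δ := by
    intro z hz _
    have hz' : M < Kerr.radius a z := by linarith
    have hr : 0 < Kerr.radius a z := hM.trans hz'
    have hδ'δ : δ' ≤ δ := hδ'.trans hδ₀δ
    refine ⟨(hC0 z hz').trans ?_, (hC1 z hz').trans ?_⟩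
    · rw [div_le_iff₀ hr]
      have h1 : δ' * M ≤ δ * M := mul_le_mul_of_nonneg_right hδ'δ hM.le
      have h2 : δ * M ≤ δ * Kerr.radius a z := mul_le_mul_of_nonneg_left hz'.le hδ.le
      linarith
    · rw [div_le_iff₀ (by positivity)]
      have h1 : δ' * M ≤ δ * M * M := by
        have := mul_le_mul_of_nonneg_right (hδ'.trans hδ₀δM) hM.le
        linarith
      have h2 : δ * M * M ≤ δ * Kerr.radius a z ^ 2 := by
        have hMr : M * M ≤ Kerr.radius a z ^ 2 := by nlinarith
        have := mul_le_mul_of_nonneg_left hMr hδ.le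
        linarith
      linarith
  have hmain := hloc 𝓢 Φ hΦs hinj hclose x.1 hxlo hxR
  rw [hΦΨ x] at hmain
  refine LorentzianMetric.chronologicalPast_mono ?_ hmain
  rintro _ ⟨y, hy, rfl⟩
  have hyR : R < Kerr.radius a y := hy
  have hyM : M < Kerr.radius a y := by linarith
  exact ⟨⟨y, hmem y hyM⟩, hyR, (hΦΨ ⟨y, hmem y hyM⟩).symm⟩

/-- **The band `{r₊ + η ≤ r ≤ R(ℓ)}` lies in `I⁻(farZone R(ℓ))`, UNIFORMLY over a compact set of
labels** (one tolerance; `R` continuous on the label set, `R(ℓ) ≥ r₊(ℓ) + η`): from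
`Theorems.stub_docLocalisationU`, `Theorems.stub_kerrBilin_coercive_exteriorU` and a positive lower
bound of the masses. [folklore] -/
theorem farSilent_band_subset_pastFarZoneU :
    ∀ (Kℓ : Set (ℝ × ℝ)) (η : ℝ) (R : ℝ × ℝ → ℝ), IsCompact Kℓ →
      (∀ ℓ ∈ Kℓ, 0 < ℓ.1 ∧ |ℓ.2| < ℓ.1) → 0 < η → ContinuousOn R Kℓ →
      (∀ ℓ ∈ Kℓ, Kerr.rPlus ℓ.1 ℓ.2 + η ≤ R ℓ) →
      ∃ δ₀ : ℝ, 0 < δ₀ ∧ ∀ ℓ ∈ Kℓ,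
      ∀ (𝓢 : Spacetime.{0} 4) [𝓢.metric.HasLeviCivita]
        (Ψ : (starBG ℓ.1 ℓ.2).domain → 𝓢.carrier) (k : ℕ) (δ' : ℝ), 1 ≤ k → δ' ≤ δ₀ →
        FarSilentNearKerr 𝓢 ℓ.1 ℓ.2 Ψ k δ' →
        ∀ x : (starBG ℓ.1 ℓ.2).domain, Kerr.rPlus ℓ.1 ℓ.2 + η ≤ Kerr.radius ℓ.2 x.1 →
          Kerr.radius ℓ.2 x.1 ≤ R ℓ →
          Ψ x ∈ 𝓢.metric.chronologicalPast 𝓢.timeOrientation (farZone 𝓢 ℓ.1 ℓ.2 Ψ (R ℓ)) := by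
  intro Kℓ η R hK hlab hη hRc hR
  obtain ⟨δ, hδ, hlocU⟩ := Theorems.stub_docLocalisationU Kℓ η R hK hlab hη hRc hR
  obtain ⟨β, hβ, hcoerU⟩ := Theorems.stub_kerrBilin_coercive_exteriorU Kℓ (fun ℓ => ℓ.1) hK
    (fun ℓ hℓ ↦ (hlab ℓ hℓ).1.le) continuous_fst.continuousOn (fun ℓ hℓ ↦ (hlab ℓ hℓ).1)
  obtain ⟨m₁, hm₁, hm₁le⟩ := hK.exists_forall_le' continuous_fst.continuousOn
    (fun ℓ hℓ ↦ (hlab ℓ hℓ).1)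
  refine ⟨min (β / 2) (δ * min 1 m₁), lt_min (by positivity) (by positivity), ?_⟩
  intro ℓ hℓ 𝓢 _ Ψ k δ' hk hδ' hFS x hxlo hxR
  have hδ'' : δ' ≤ min (β / 2) (δ * min 1 ℓ.1) :=
    hδ'.trans (min_le_min le_rfl
      (mul_le_mul_of_nonneg_left (min_le_min le_rfl (hm₁le ℓ hℓ)) hδ.le))
  exact farSilent_band_subset_pastFarZone_of (hlab ℓ hℓ).1 hη hδ hβ (hcoerU ℓ hℓ)
    (hlocU ℓ hℓ) 𝓢 Ψ k δ' hk hδ'' hFS x hxlo hxR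

/-- `I⁻(I⁻(A)) ⊆ I⁻(A)` (transitivity of `≪`, O'Neill 1983, Ch. 14, p. 402, read for the
reversed time orientation). [cite: ONeill1983, Ch. 14, p. 402] -/
theorem chronologicalPast_chronologicalPast_subset (𝓢 : Spacetime.{0} 4) (A : Set 𝓢.carrier) :
    𝓢.metric.chronologicalPast 𝓢.timeOrientation (𝓢.metric.chronologicalPast 𝓢.timeOrientation A) ⊆
      𝓢.metric.chronologicalPast 𝓢.timeOrientation A := by
  intro q hq
  unfold LorentzianMetric.chronologicalPast at hq ⊢
  rw [LorentzianMetric.chronologicalFuture_eq_biUnion] at hq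
  simp only [mem_iUnion, exists_prop] at hq
  obtain ⟨p, hp, hpq⟩ := hq
  exact LorentzianMetric.mem_chronologicalFuture_trans hp hpq

/-- **Squeeze for chronological pasts.** If `A ⊆ S ⊆ B` and `B ⊆ I⁻(A)` then `I⁻(S) = I⁻(A)`.
[folklore] -/
theorem chronologicalPast_eq_of_squeeze (𝓢 : Spacetime.{0} 4) {A S B : Set 𝓢.carrier}
    (hAS : A ⊆ S) (hSB : S ⊆ B) (hB : B ⊆ 𝓢.metric.chronologicalPast 𝓢.timeOrientation A) :
    𝓢.metric.chronologicalPast 𝓢.timeOrientation S = 𝓢.metric.chronologicalPast 𝓢.timeOrientation A := by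
  refine Subset.antisymm ?_ (LorentzianMetric.chronologicalPast_mono hAS)
  exact ((LorentzianMetric.chronologicalPast_mono hSB).trans
    (LorentzianMetric.chronologicalPast_mono hB)).trans (chronologicalPast_chronologicalPast_subset 𝓢 A)

/-- **The d.o.c. of an eternal near-Kerr star chart is independent of the far zone defining it,
UNIFORMLY over a compact set of labels (rev c13).** There is ONE tolerance `δ₀ > 0` such that at
every label of `Kℓ ⊆ {0 < M, |a| < M}`, under `FarSilentNearKerr` at order `k ≥ 1` and tolerance
`δ' ≤ δ₀`, EVERY set `S` with `farZone (13M/4) ⊆ S ⊆ farZone (11M/4)` has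
`I⁻(S) = docOf = I⁻(farZone (3M))`. Proof: `farZone (11M/4) ⊆ I⁻(farZone (13M/4))` — far points
because the far zone is open (F4), band points `11M/4 < r ≤ 13M/4` by
`farSilent_band_subset_pastFarZoneU` with `η = M/2` (`r₊ + M/2 ≤ 5M/2`) and `R = 13M/4` — then the
squeeze, applied to `S` and to `farZone (3M)`. This is the set-bookkeeping input of the S6 re-split:
a re-charting moving radii by `≤ M/4` sees the same `docOf` and the same charted horizon.
[folklore] -/
theorem docOf_eq_chronologicalPast_of_sandwichU :
    ∀ (Kℓ : Set (ℝ × ℝ)), IsCompact Kℓ → (∀ ℓ ∈ Kℓ, 0 < ℓ.1 ∧ |ℓ.2| < ℓ.1) →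
      ∃ δ₀ : ℝ, 0 < δ₀ ∧ ∀ ℓ ∈ Kℓ,
      ∀ (𝓢 : Spacetime.{0} 4) [𝓢.metric.HasLeviCivita]
        (Ψ : (starBG ℓ.1 ℓ.2).domain → 𝓢.carrier) (k : ℕ) (δ' : ℝ), 1 ≤ k → δ' ≤ δ₀ →
        FarSilentNearKerr 𝓢 ℓ.1 ℓ.2 Ψ k δ' →
        ∀ S : Set 𝓢.carrier, farZone 𝓢 ℓ.1 ℓ.2 Ψ (13 * ℓ.1 / 4) ⊆ S →
          S ⊆ farZone 𝓢 ℓ.1 ℓ.2 Ψ (11 * ℓ.1 / 4) →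
          𝓢.metric.chronologicalPast 𝓢.timeOrientation S = docOf 𝓢 ℓ.1 ℓ.2 Ψ := by
  intro Kℓ hK hlab
  -- masses are bounded below on the compact label set, so `η := m₁ / 2` is one positive width
  obtain ⟨m₁, hm₁, hm₁le⟩ := hK.exists_forall_le' continuous_fst.continuousOn
    (fun ℓ hℓ ↦ (hlab ℓ hℓ).1)
  have hrp2 : ∀ ℓ ∈ Kℓ, Kerr.rPlus ℓ.1 ℓ.2 ≤ 2 * ℓ.1 := by
    intro ℓ hℓ
    have hM := (hlab ℓ hℓ).1
    have h := Real.sqrt_le_sqrt (show ℓ.1 ^ 2 - ℓ.2 ^ 2 ≤ ℓ.1 ^ 2 by linarith only [sq_nonneg ℓ.2])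
    rw [Real.sqrt_sq hM.le] at h
    unfold Kerr.rPlus; linarith
  have hRc : ContinuousOn (fun ℓ : ℝ × ℝ => 13 * ℓ.1 / 4) Kℓ :=
    ((continuous_const.mul continuous_fst).div_const _).continuousOn
  obtain ⟨δ₀, hδ₀, H⟩ := farSilent_band_subset_pastFarZoneU Kℓ (m₁ / 2) (fun ℓ => 13 * ℓ.1 / 4) hK
    hlab (by positivity) hRc (fun ℓ hℓ ↦ by
      have := hrp2 ℓ hℓ; have := hm₁le ℓ hℓ; linarith)
  refine ⟨δ₀, hδ₀, ?_⟩
  intro ℓ hℓ 𝓢 _ Ψ k δ' hk hδ' hFS S hS₁ hS₂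
  have hM := (hlab ℓ hℓ).1
  have hΨe : Topology.IsOpenEmbedding Ψ := hFS.2.2.1
  -- `farZone (11M/4) ⊆ I⁻(farZone (13M/4))`
  have hkey : farZone 𝓢 ℓ.1 ℓ.2 Ψ (11 * ℓ.1 / 4) ⊆
      𝓢.metric.chronologicalPast 𝓢.timeOrientation (farZone 𝓢 ℓ.1 ℓ.2 Ψ (13 * ℓ.1 / 4)) := by
    rintro _ ⟨x, hx, rfl⟩
    have hx' : 11 * ℓ.1 / 4 < Kerr.radius ℓ.2 x.1 := hx
    rcases le_or_gt (Kerr.radius ℓ.2 x.1) (13 * ℓ.1 / 4) with hxR | hxR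
    · exact H ℓ hℓ 𝓢 Ψ k δ' hk hδ' hFS x
        (by have := hrp2 ℓ hℓ; have := hm₁le ℓ hℓ; linarith) hxR
    · exact Theorems.stub_subset_chronologicalPast_of_isOpen 𝓢 _
        (hΨe.isOpenMap _ ((isOpen_lt continuous_const (Kerr.continuous_radius ℓ.2)).preimage
          continuous_subtype_val)) ⟨x, hxR, rfl⟩
  have hmono : ∀ R₁ R₂ : ℝ, R₁ ≤ R₂ → farZone 𝓢 ℓ.1 ℓ.2 Ψ R₂ ⊆ farZone 𝓢 ℓ.1 ℓ.2 Ψ R₁ := by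
    rintro R₁ R₂ h _ ⟨x, hx, rfl⟩
    exact ⟨x, lt_of_le_of_lt h hx, rfl⟩
  have h1 := chronologicalPast_eq_of_squeeze 𝓢 hS₁ hS₂ hkey
  have h2 := chronologicalPast_eq_of_squeeze 𝓢 (hmono (3 * ℓ.1) _ (by linarith))
    (hmono _ (3 * ℓ.1) (by linarith)) hkey
  unfold docOf
  rw [h1, ← h2]

end Summit.FinalStateConjecture.FinalStateConjecture.Theorems.PhotonShellNode

end
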